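import Mathlib
import Literature.Geometry.Lorentzian.KlainermanSzeftel2021.Bootstrap
import Summits.FinalStateConjecture.FinalStateConjecture.Theorems.RunbookKerrSkeletonSanity

/-!
# Runbook sanity module (2) — the PT predicates of the Klainerman–Szeftel (2021) bootstrap skeleton

Companion to `RunbookKerrSkeletonSanity` (p212991): REVIEW-RUNBOOK.md of the bundle
`papers/FinalStateConjecture/kerr-skeleton`, definition cards D39 `BA_PT` and D40 `PTBound` — the
bootstrap assumption **BA-PT** `𝔖_k + ℜ_k ≤ ε (k ≤ k_large + 7)` (KS l.24316–24319) and the Main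
PT-Theorem conclusion `𝔖_k + ℜ_k ≤ c_PT ε0` (KS Theorem 9.4.10, (9.4.14)).  Both are predicates on a
spacetime `X : S.M` of a `Setting`; this file shows each is genuinely CONTINGENT on the setting: it
HOLDS on the toy setting of the companion module (all PT norms `0`, `ε = 1/4`, `c_PT · ε0 = 1 · 1/8`)
and FAILS on the same setting with every PT norm raised to `1`.  Consistency-only witnesses (they say
nothing about Kerr): they certify that the hypothesis shapes the kernel-checked implication
`mainTheorem_of_leaves` quantifies over are neither tautologies nor contradictions.
-/

namespace Summit.FinalStateConjecture.Runbook.KerrSkeleton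

open Literature.Geometry.Lorentzian.KlainermanSzeftel2021.Bootstrap

section PT
variable (lim : Prop)

/-- The toy setting with every PT norm `𝔖_k + ℜ_k` equal to `1` instead of `0` (all other fields
unchanged): the PT predicates fail on it. -/
noncomputable def toySettingPT : Setting toyConstants := { toySetting lim with ptNorm := fun _ _ => 1 }

/-- unit PT norms on `toySettingPT`. -/
@[simp] theorem toySettingPT_ptNorm (X : (toySettingPT lim).M) (k : ℕ) : (toySettingPT lim).ptNorm X k = 1 := rfl

/-- **BA-PT holds on the toy setting** (`0 ≤ ε = 1/4` for every `k ≤ k_large + 7 = 12`). -/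
theorem toy_BA_PT (X : (toySetting lim).M) : BA_PT (toySetting lim) X :=
  fun _ _ => by norm_num [toyConstants]

/-- **The Main-PT conclusion holds on the toy setting** (`0 ≤ c_PT · ε0 = 1 · 1/8`). -/
theorem toy_PTBound (X : (toySetting lim).M) : PTBound toyLes (toySetting lim) X :=
  fun _ _ => by norm_num [toyLes, toyConstants]

/-- **BA-PT fails once the PT norms are `1`**: at `k = 0`, `1 ≤ 1/4` is false. -/
theorem toyPT_not_BA_PT (X : (toySettingPT lim).M) : ¬ BA_PT (toySettingPT lim) X := by
  intro h
  have h0 := h 0 (Nat.zero_le _)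
  norm_num [toySettingPT, toyConstants] at h0

/-- **The Main-PT conclusion fails once the PT norms are `1`**: at `k = 0`, `1 ≤ 1 · 1/8` is false. -/
theorem toyPT_not_PTBound (X : (toySettingPT lim).M) : ¬ PTBound toyLes (toySettingPT lim) X := by
  intro h
  have h0 := h 0 (Nat.zero_le _)
  norm_num [toySettingPT, toyLes, toyConstants] at h0

/-- Both PT predicates are therefore genuinely contingent on the setting (neither a tautology nor a
contradiction): each has a model and a counter-model among settings over the SAME admissible constants. -/
theorem pt_predicates_contingent :
    (∃ (S : Setting toyConstants) (X : S.M), BA_PT S X ∧ PTBound toyLes S X) ∧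
      ∃ (S : Setting toyConstants) (X : S.M), ¬ BA_PT S X ∧ ¬ PTBound toyLes S X :=
  ⟨⟨toySetting True, (0 : ℝ), toy_BA_PT True _, toy_PTBound True _⟩,
    ⟨toySettingPT True, (0 : ℝ), toyPT_not_BA_PT True _, toyPT_not_PTBound True _⟩⟩

end PT

end Summit.FinalStateConjecture.Runbook.KerrSkeleton
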